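import Literature.Geometry.Lorentzian.KerrDataSchwarzschildExtrinsic
import Literature.Geometry.Lorentzian.LeviCivitaCovDerivProofs
import Literature.Geometry.Lorentzian.MetricNormSq
import HarnessLib

/-!
# The Schwarzschild (`a = 0`) Kerr–Schild slice data in closed form, III: the constraints

Final support file (all results proved, no named facts) of the verification that the
Schwarzschild initial data `Kerr.data M 0 r₀` — the data induced by the Kerr–Schild metric
`g = η + (2M/r) ℓ ⊗ ℓ` on the slice `{t* = 0} ∩ {r > max r₀ 0}` — solve the **vacuum constraint
equations**, i.e. the `a = 0` instance of the named fact `Kerr.data_isVacuumConstraintSolution`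
(`KerrData.lean`; Choquet-Bruhat 2009, Ch. VI, Thm. 3.3; Cook, Living Rev. Relativ. 3 (2000) 5,
§3.2.2, (55)–(57); García-Parrado–Valiente Kroon, J. Geom. Phys. 58 (2008), §5):

* `Kerr.data_isVacuumConstraintSolution_zero : Kerr.data_isVacuumConstraintSolution M 0 r₀`.

With `r = ‖y‖`, `S = √(1 + 2M/r)` and the closed forms of the companion files
(`h = δ + (2M/r³) y ⊗ y`, `R(h) = 8M²/(r²(r+2M)²)`, `k = −(2M/(r²S))(δ − ((2 + M/r)/r²) y ⊗ y)`):

* `Kerr.traceK_data_zero` — `tr_h k = −2M (r + 3M) / (r² S (r + 2M))` (Cook 2000, (57):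
  `K = 2Mα³(1 + 3M/r)/r²` up to the sign convention);
* `Kerr.normSqK_data_zero` — `|k|²_h = (4M²/(r⁴ S²)) (2 + (r + M)²/(r + 2M)²)`;
* `Kerr.hamiltonianConstraintFn_data_zero` — **the Hamiltonian constraint** `R(h) − |k|² + (tr k)² = 0`;
* `Kerr.christoffel_hRep` — the Christoffel map of `h` in vector form,
  `Γ_y(Y)(X) = (r/(r + 2M)) c(X, Y) y`;
* `Kerr.covDeriv₂_data_k_zero` — `(∇_Z k)(X, Y) = ∂_Z k(X, Y) − k(Γ(X)(Z), Y) − k(X, Γ(Y)(Z))`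
  on the slice, with the derivative `Kerr.fderiv_kRep_apply` of the closed form;
* `Kerr.momentumConstraintFn_data_zero` — **the momentum constraint** `div_h k − d(tr_h k) = 0`,
  checked on an orthonormal basis adapted to the point.

## References

* Y. Choquet-Bruhat, *General Relativity and the Einstein Equations* (2009), Ch. VI, Thm. 3.3.
* G. B. Cook, *Initial data for numerical relativity*, Living Rev. Relativ. 3 (2000) 5, §3.2.2,
  (55)–(57).
* A. García-Parrado, J. A. Valiente Kroon, *Kerr initial data*, J. Geom. Phys. 58 (2008), §5.
* B. O'Neill, *Semi-Riemannian geometry* (1983), Ch. 3, Prop. 3.13, Def. 3.16–3.17, p. 86.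
-/

noncomputable section

-- instance search through the nested operator types (as in `ChartCurvature`)
set_option maxSynthPendingDepth 3

open Bundle TopologicalSpace Manifold Set Module
open scoped ContDiff Topology InnerProductSpace

namespace Literature.Geometry.Lorentzian

namespace Kerr

/-! ### The mean curvature `tr_h k` and `|k|²_h` -/

section Adapted

variable {M : ℝ} {y : E3} (b : OrthonormalBasis (Fin 3) ℝ E3) (hb : b 2 = ‖y‖⁻¹ • y)

include hb in
/-- **The second fundamental form in the adapted frame**:
`k(bᵢ, bⱼ) = −(2M/(r²S)) (δᵢⱼ − (2 + M/r) δᵢ₂ δⱼ₂)`. [cite: Cook2000, §3.2.2 (57)] -/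
theorem kRep_adapted (i j : Fin 3) :
    kRep M y (b i) (b j) = -(2 * M / (‖y‖ ^ 2 * √(1 + 2 * M / ‖y‖))) *
      ((if i = j then 1 else 0) - (2 + M / ‖y‖) * ((if i = 2 then 1 else 0) * (if j = 2 then 1 else 0))) := by
  rw [kRep, inner_basis, inner_adapted b hb, inner_adapted b hb]
  by_cases hr : ‖y‖ = 0
  · simp [hr]
  · congr 1
    split_ifs <;> field_simp <;> ring

end Adapted

/-- The mean curvature of the Schwarzschild slice as a function on `E3`:
`trRep M y = −2M (r + 3M) / (r² S (r + 2M))`, `S = √(1 + 2M/r)`. Cook 2000, (57)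
(`K = 2Mα³ r⁻² (1 + 3M/r)`, `α = S⁻¹`, up to the sign convention). [cite: Cook2000, §3.2.2 (57)] -/
def trRep (M : ℝ) (y : E3) : ℝ :=
  -(2 * M * (‖y‖ + 3 * M) / (‖y‖ ^ 2 * √(1 + 2 * M / ‖y‖) * (‖y‖ + 2 * M)))

/-- **The mean curvature of the Schwarzschild Kerr–Schild slice**: for `M ≥ 0`,
`tr_h k (y) = −2M (r + 3M) / (r² S (r + 2M))` (`= −2Mα³(1 + 3M/r)/r²`). Cook 2000, §3.2.2, (57).
[cite: Cook2000, §3.2.2 (57)] -/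
theorem traceK_data_zero [Facts] [SliceFacts] (M : ℝ) (hM : 0 ≤ M) {r₀ : ℝ} (y : slice 0 r₀) :
    (data M 0 r₀ hM).traceK y = trRep M y := by
  have hy : (y : E3) ≠ 0 := ne_zero_of_mem_slice_zero y
  have hr : ‖(y : E3)‖ ≠ 0 := norm_ne_zero_iff.2 hy
  have hrM : ‖(y : E3)‖ + 2 * M ≠ 0 := by
    have := norm_pos_of_mem_slice_zero y; positivity
  have hS : √(1 + 2 * M / ‖(y : E3)‖) ≠ 0 :=
    (Real.sqrt_pos.2 (by have := norm_pos_of_mem_slice_zero y; positivity)).ne'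
  obtain ⟨b, hb⟩ := exists_orthonormalBasis_adapted hy
  set β : Module.Basis (Fin 3) ℝ (TangentSpace 𝓘(ℝ, E3) y) := b.toBasis with hβdef
  have hβ : ∀ i, β i = b i := fun i ↦ congrFun b.coe_toBasis i
  rw [InitialDataSet.traceK, trace_eq_sum_gram_inv _ y β]
  simp only [hβ, InitialDataSet.kBilin_apply, data_k_zero_apply, data_metric_val_zero M hM y]
  change ∑ i, ∑ j, (Matrix.of fun i j ↦ hRep M y (b i) (b j))⁻¹ j i * kRep M y (b i) (b j) = _
  rw [gram_hRep_adapted_inv hy b hb hrM]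
  simp only [Matrix.diagonal_apply, ite_mul, zero_mul, Finset.sum_ite_eq', Finset.mem_univ,
    if_true, kRep_adapted b hb, Fin.sum_univ_three, Fin.isValue, Matrix.cons_val_zero,
    Matrix.cons_val_one, Matrix.cons_val, show ((0 : Fin 3) = 2) = False by decide,
    show ((1 : Fin 3) = 2) = False by decide, if_false, trRep]
  field_simp
  ring

/-- `|k|²_h` of the Schwarzschild slice as a function on `E3`:
`(4M²/(r⁴ S²)) (2 + (r + M)²/(r + 2M)²)`. [cite: Cook2000, §3.2.2 (57)] -/
def normSqRep (M : ℝ) (y : E3) : ℝ :=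
  4 * M ^ 2 / (‖y‖ ^ 4 * (1 + 2 * M / ‖y‖)) * (2 + (‖y‖ + M) ^ 2 / (‖y‖ + 2 * M) ^ 2)

/-- **`|k|²_h` of the Schwarzschild Kerr–Schild slice**: for `M ≥ 0`,
`|k|²_h (y) = (4M²/(r⁴ S²)) (2 + (r + M)²/(r + 2M)²)` (in the adapted frame `k` and `h` are both
diagonal). Cook 2000, §3.2.2, (57). [cite: Cook2000, §3.2.2 (57)] -/
theorem normSqK_data_zero [Facts] [SliceFacts] (M : ℝ) (hM : 0 ≤ M) {r₀ : ℝ} (y : slice 0 r₀) :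
    (data M 0 r₀ hM).normSqK y = normSqRep M y := by
  have hy : (y : E3) ≠ 0 := ne_zero_of_mem_slice_zero y
  have hr : ‖(y : E3)‖ ≠ 0 := norm_ne_zero_iff.2 hy
  have hrpos := norm_pos_of_mem_slice_zero y
  have hrM : ‖(y : E3)‖ + 2 * M ≠ 0 := by positivity
  have h1S : 1 + 2 * M / ‖(y : E3)‖ ≠ 0 := by positivity
  have hS : √(1 + 2 * M / ‖(y : E3)‖) ≠ 0 := (Real.sqrt_pos.2 (by positivity)).ne'
  have hS2 : √(1 + 2 * M / ‖(y : E3)‖) ^ 2 = 1 + 2 * M / ‖(y : E3)‖ := Real.sq_sqrt (by positivity)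
  obtain ⟨b, hb⟩ := exists_orthonormalBasis_adapted hy
  set β : Module.Basis (Fin 3) ℝ (TangentSpace 𝓘(ℝ, E3) y) := b.toBasis with hβdef
  have hβ : ∀ i, β i = b i := fun i ↦ congrFun b.coe_toBasis i
  -- the adapted frame is `h`-orthogonal with non-null vectors
  have hval : ∀ i j, (data M 0 r₀ hM).metric.val y (β i) (β j) = hRep M y (b i) (b j) := by
    intro i j; rw [data_metric_val_zero M hM y, hβ, hβ]; rfl
  have hortho : ((data M 0 r₀ hM).metric.toBilinForm y).IsOrthoᵢ β := by
    rw [LinearMap.isOrthoᵢ_def]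
    intro i j hij
    rw [PseudoRiemannianMetric.toBilinForm_apply, hval, hRep_adapted b hb, if_neg hij]
    have : ¬ (i = 2 ∧ j = 2) := fun h ↦ hij (h.1.trans h.2.symm)
    by_cases hi : i = 2
    · simp [hi, show j ≠ 2 from fun hj ↦ this ⟨hi, hj⟩]
    · simp [hi]
  have hnn : ∀ i, (data M 0 r₀ hM).metric.val y (β i) (β i) ≠ 0 := by
    intro i
    rw [hval, hRep_adapted b hb, if_pos rfl]
    by_cases hi : i = 2
    · simp only [hi, if_true, mul_one]
      field_simp
      positivity
    · simp [hi]
  rw [InitialDataSet.normSqK, PseudoRiemannianMetric.normSq_eq_sum_sq _ y β hortho hnn]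
  simp only [hval]
  simp only [hβ, InitialDataSet.kBilin_apply, data_k_zero_apply, kRep_adapted b hb,
    hRep_adapted b hb, Fin.sum_univ_three, Fin.isValue,
    show ((0 : Fin 3) = 2) = False by decide, show ((1 : Fin 3) = 2) = False by decide,
    show ((0 : Fin 3) = 1) = False by decide, show ((1 : Fin 3) = 0) = False by decide,
    show ((2 : Fin 3) = 0) = False by decide, show ((2 : Fin 3) = 1) = False by decide,
    if_true, if_false, normSqRep]
  simp only [mul_pow, div_pow, even_two, Even.neg_pow, hS2]
  field_simp
  ring

/-- **The Hamiltonian constraint for the Schwarzschild Kerr–Schild slice**: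
`R(h) − |k|²_h + (tr_h k)² = 0` (`8M²/(r²(r+2M)²) − (4M²/(r⁴S²))(2 + (r+M)²/(r+2M)²)
+ 4M²(r+3M)²/(r⁴S²(r+2M)²) = 0` with `S² = 1 + 2M/r`). Choquet-Bruhat 2009, Ch. VI, Thm. 3.3
and (3.12); Cook 2000, §3.2.2. [cite: ChoquetBruhat2009, Ch. VI, Thm. 3.3] -/
theorem hamiltonianConstraintFn_data_zero [Facts] [SliceFacts] (M : ℝ) (hM : 0 ≤ M) {r₀ : ℝ}
    (y : slice 0 r₀) [(data M 0 r₀ hM).metric.HasLeviCivita] :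
    (data M 0 r₀ hM).hamiltonianConstraintFn y = 0 := by
  have hy : (y : E3) ≠ 0 := ne_zero_of_mem_slice_zero y
  have hr : ‖(y : E3)‖ ≠ 0 := norm_ne_zero_iff.2 hy
  have hrpos := norm_pos_of_mem_slice_zero y
  have hrM : ‖(y : E3)‖ + 2 * M ≠ 0 := by positivity
  have h1S : 1 + 2 * M / ‖(y : E3)‖ ≠ 0 := by positivity
  have hS2 : √(1 + 2 * M / ‖(y : E3)‖) ^ 2 = 1 + 2 * M / ‖(y : E3)‖ := Real.sq_sqrt (by positivity)
  rw [InitialDataSet.hamiltonianConstraintFn, scalarCurvature_data_zero M hM y,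
    normSqK_data_zero M hM y, traceK_data_zero M hM y, normSqRep, trRep]
  simp only [mul_pow, div_pow, even_two, Even.neg_pow, hS2]
  field_simp
  ring

/-! ### The Christoffel map of `h` and the covariant derivative of `k` -/

/-- **The Christoffel map of the Schwarzschild slice metric in vector form**: on the slice,
`Γ_y(Y)(X) = ∇_X Y = (r/(r + 2M)) c(X, Y) y` (`h(Γ(Y)(X), ·) = ½ K(Y, X, ·) = c(X, Y) ⟪y, ·⟫`
by `koszulForm_hRep`, and `h(y, ·) = (1 + 2M/r) ⟪y, ·⟫`). O'Neill 1983, Ch. 3, Prop. 3.13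
(`Γᵏᵢⱼ = ½ gᵏᵐ(∂ᵢ g_jm + ∂ⱼ g_im − ∂_m g_ij)`). [cite: ONeill1983, Ch. 3, Prop. 3.13] -/
theorem christoffel_data_zero [Facts] [SliceFacts] (M : ℝ) (hM : 0 ≤ M) {r₀ : ℝ}
    (y : slice 0 r₀) (Y X : E3) :
    OpensChart.christoffel (data M 0 r₀ hM).metric (hRep M) y Y X =
      ((‖(y : E3)‖ / (‖(y : E3)‖ + 2 * M)) * cKS M y X Y) • (y : E3) := by
  have hy : (y : E3) ≠ 0 := ne_zero_of_mem_slice_zero y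
  have hr : ‖(y : E3)‖ ≠ 0 := norm_ne_zero_iff.2 hy
  have hrM : ‖(y : E3)‖ + 2 * M ≠ 0 := by
    have := norm_pos_of_mem_slice_zero y; positivity
  rw [OpensChart.christoffel_apply]
  refine PseudoRiemannianMetric.sharp_eq_of_forall _ y _ _ fun w ↦ ?_
  simp only [data_metric_val_zero M hM y]
  change hRep M y (((‖(y : E3)‖ / (‖(y : E3)‖ + 2 * M)) * cKS M y X Y) • (y : E3)) w =
    2⁻¹ * OpensChart.koszulForm (hRep M) y Y X w
  rw [koszulForm_hRep M hy, hRep_apply, inner_smul_left, inner_smul_right,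
    real_inner_self_eq_norm_sq]
  simp only [conj_trivial]
  field_simp

/-- The directional derivative `∂_Z k(X, Y)` of the closed form `kRep` (with `t = ⟪y, Z⟫`,
`S = √(1 + 2M/r)`, `C = 2M/(r²S)`, `q = (2 + M/r)/r²`, `P = ⟪y,X⟫⟪y,Y⟫`):
`C (dq P + q dP) − dC (⟪X,Y⟫ − qP)` where `d(r²S) = 2tS − Mt/(rS)`, `dC = −2M d(r²S)/(r²S)²`,
`dq = −Mt/r⁵ − 2t(2 + M/r)/r⁴`, `dP = ⟪X,Z⟫⟪y,Y⟫ + ⟪y,X⟫⟪Y,Z⟫`. [cite: Cook2000, §3.2.2 (57)] -/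
def dkRep (M : ℝ) (y Z X Y : E3) : ℝ :=
  let r := ‖y‖
  let S := √(1 + 2 * M / ‖y‖)
  let t := ⟪y, Z⟫_ℝ
  let C := 2 * M / (r ^ 2 * S)
  let dA := 2 * t * S - M * t / (r * S)
  let dC := -(2 * M) * dA / (r ^ 2 * S) ^ 2
  let q := (2 + M / r) / r ^ 2
  let dq := -(M * t) / r ^ 5 - 2 * t * (2 + M / r) / r ^ 4
  let P := ⟪y, X⟫_ℝ * ⟪y, Y⟫_ℝ
  let dP := ⟪X, Z⟫_ℝ * ⟪y, Y⟫_ℝ + ⟪y, X⟫_ℝ * ⟪Y, Z⟫_ℝ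
  C * (dq * P + q * dP) - dC * (⟪X, Y⟫_ℝ - q * P)

section KRepCalculus

variable {M : ℝ} {y : E3}

/-- `y ↦ r² S = ‖y‖² √(1 + 2M/‖y‖)` has derivative `Z ↦ 2tS − Mt/(rS)`, `t = ⟪y, Z⟫` (`M ≥ 0`,
`y ≠ 0`). [folklore] -/
theorem hasFDerivAt_normSq_mul_sqrt (hM : 0 ≤ M) (hy : y ≠ 0) :
    HasFDerivAt (fun y : E3 ↦ ‖y‖ ^ 2 * √(1 + 2 * M / ‖y‖))
      ((2 * √(1 + 2 * M / ‖y‖) - M / (‖y‖ * √(1 + 2 * M / ‖y‖))) • E3.covec y) y := by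
  have hr : ‖y‖ ≠ 0 := norm_ne_zero_iff.2 hy
  have hpos : 0 < 1 + 2 * M / ‖y‖ := by have := norm_pos_iff.2 hy; positivity
  have hS : √(1 + 2 * M / ‖y‖) ≠ 0 := (Real.sqrt_pos.2 hpos).ne'
  have h1 : HasFDerivAt (fun y : E3 ↦ ‖y‖ ^ 2) (2 • (innerSL ℝ y : E3 →L[ℝ] ℝ)) y :=
    (hasStrictFDerivAt_norm_sq y).hasFDerivAt
  rw [← Nat.cast_smul_eq_nsmul ℝ] at h1
  have hu : HasFDerivAt (fun y : E3 ↦ 1 + 2 * M / ‖y‖ ^ 1)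
      ((-(2 * M * (1 : ℕ)) / ‖y‖ ^ (1 + 2)) • E3.covec y) y :=
    (hasFDerivAt_const_div_norm_pow (2 * M) hy 1).const_add 1
  have hu' : HasFDerivAt (fun y : E3 ↦ 1 + 2 * M / ‖y‖)
      ((-(2 * M * (1 : ℕ)) / ‖y‖ ^ (1 + 2)) • E3.covec y) y := by
    simpa only [pow_one] using hu
  have h2 := hu'.sqrt hpos.ne'
  refine (h1.mul h2).congr_fderiv ?_
  ext v
  simp only [add_apply, FunLike.coe_smul, Pi.smul_apply, smul_eq_mul, innerSL_apply_apply,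
    E3.covec_apply]
  push_cast
  field_simp
  ring

/-- **The closed form `kRep` is differentiable in the point, with directional derivative
`dkRep`** (`M ≥ 0`, `y ≠ 0`). [cite: Cook2000, §3.2.2 (57)] -/
theorem hasFDerivAt_kRep (hM : 0 ≤ M) (hy : y ≠ 0) (X Y : E3) :
    ∃ D : E3 →L[ℝ] ℝ, HasFDerivAt (fun y : E3 ↦ kRep M y X Y) D y ∧ ∀ Z, D Z = dkRep M y Z X Y := by
  have hr : ‖y‖ ≠ 0 := norm_ne_zero_iff.2 hy
  have hrpos : 0 < ‖y‖ := norm_pos_iff.2 hy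
  have hpos : 0 < 1 + 2 * M / ‖y‖ := by positivity
  have hS : √(1 + 2 * M / ‖y‖) ≠ 0 := (Real.sqrt_pos.2 hpos).ne'
  have hA := hasFDerivAt_normSq_mul_sqrt hM hy
  have hA0 : ‖y‖ ^ 2 * √(1 + 2 * M / ‖y‖) ≠ 0 := by positivity
  have hC := ((hasDerivAt_inv hA0).comp_hasFDerivAt y hA).const_mul (2 * M)
  have hq := ((hasFDerivAt_const_div_norm_pow M hy 1).const_add 2).mul
    (hasFDerivAt_inv_norm_pow hy 2)
  have hP := (hasFDerivAt_inner_left y X).mul (hasFDerivAt_inner_left y Y)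
  have h := hC.neg.mul ((hasFDerivAt_const ⟪X, Y⟫_ℝ y).sub (hq.mul hP))
  refine ⟨_, h.congr_of_eventuallyEq (Filter.Eventually.of_forall fun y' ↦ ?_), fun Z ↦ ?_⟩
  · simp only [kRep, Pi.mul_apply, Pi.sub_apply, Pi.neg_apply, Function.comp_apply, pow_one]
    ring
  · simp only [dkRep, add_apply, neg_apply, FunLike.coe_smul,
      Pi.smul_apply, smul_eq_mul, E3.covec_apply,
      Pi.mul_apply, Pi.sub_apply, Pi.neg_apply, Function.comp_apply, pow_one, zero_sub, mul_neg,
      neg_mul, neg_neg, real_inner_comm Z X, real_inner_comm Z Y]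
    push_cast
    field_simp
    ring

/-- `y ↦ kRep M y X Y` is differentiable off the origin (`M ≥ 0`). [cite: Cook2000, §3.2.2 (57)] -/
theorem differentiableAt_kRep (hM : 0 ≤ M) (hy : y ≠ 0) (X Y : E3) :
    DifferentiableAt ℝ (fun y : E3 ↦ kRep M y X Y) y := by
  obtain ⟨D, hD, -⟩ := hasFDerivAt_kRep hM hy X Y
  exact hD.differentiableAt

/-- **`∂_Z k(X, Y) = dkRep M y Z X Y`** off the origin (`M ≥ 0`). [cite: Cook2000, §3.2.2 (57)] -/
theorem fderiv_kRep_apply (hM : 0 ≤ M) (hy : y ≠ 0) (X Y Z : E3) :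
    fderiv ℝ (fun y : E3 ↦ kRep M y X Y) y Z = dkRep M y Z X Y := by
  obtain ⟨D, hD, hDZ⟩ := hasFDerivAt_kRep hM hy X Y
  rw [hD.fderiv, hDZ]

end KRepCalculus

/-- **The covariant derivative of `k` on the Schwarzschild slice, in coordinates**:
`(∇_Z k)(X, Y)(y) = ∂_Z k(X, Y) − k(Γ(X)(Z), Y) − k(X, Γ(Y)(Z))` on constant fields
(`covDeriv₂_apply` with `leviCivita_const_apply`; the derivative of the components is
`fderiv_kRep_apply`). O'Neill 1983, Ch. 3, Def. 3.16–3.17 (covariant differential of a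
`(0,2)`-tensor). [cite: ONeill1983, Ch. 3, Def. 3.16–3.17] -/
theorem covDeriv₂_data_k_zero [Facts] [SliceFacts] (M : ℝ) (hM : 0 ≤ M) {r₀ : ℝ}
    (y : slice 0 r₀) [(data M 0 r₀ hM).metric.HasLeviCivita] (X Y Z : E3) :
    (data M 0 r₀ hM).metric.covDeriv₂ (data M 0 r₀ hM).k y X Y Z =
      dkRep M y Z X Y
        - kRep M y (OpensChart.christoffel (data M 0 r₀ hM).metric (hRep M) y X Z) Y
        - kRep M y X (OpensChart.christoffel (data M 0 r₀ hM).metric (hRep M) y Y Z) := by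
  have hy : (y : E3) ≠ 0 := ne_zero_of_mem_slice_zero y
  have hk := ((data M 0 r₀ hM).contMDiff_k y).mdifferentiableAt (by simp)
  have happ := PseudoRiemannianMetric.covDeriv₂_apply_holds (g := (data M 0 r₀ hM).metric)
    (x := y) (k := (data M 0 r₀ hM).k) hk (X := fun _ ↦ X) (Y := fun _ ↦ Y) (Z := fun _ ↦ Z)
    (OpensChart.mdifferentiableAt_const_section y X) (OpensChart.mdifferentiableAt_const_section y Y)
    (OpensChart.mdifferentiableAt_const_section y Z)
  rw [show (data M 0 r₀ hM).metric.covDeriv₂ (data M 0 r₀ hM).k y X Y Z =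
    (data M 0 r₀ hM).metric.covDeriv₂ (data M 0 r₀ hM).k y ((fun _ : slice 0 r₀ ↦ X) y)
      ((fun _ : slice 0 r₀ ↦ Y) y) ((fun _ : slice 0 r₀ ↦ Z) y) from rfl, happ]
  unfold PseudoRiemannianMetric.covDeriv₂Aux
  rw [OpensChart.leviCivita_const_apply (data_metric_val_zero M hM) y (differentiableAt_hRep M hy),
    OpensChart.leviCivita_const_apply (data_metric_val_zero M hM) y (differentiableAt_hRep M hy),
    OpensChart.mvfderiv_eq y (fun y' : slice 0 r₀ ↦ (data M 0 r₀ hM).k y' X Y)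
      (fun y' : E3 ↦ kRep M y' X Y) (fun y' ↦ data_k_zero_apply M hM y' X Y)
      (differentiableAt_kRep hM hy X Y),
    fderiv_kRep_apply hM hy, data_k_zero_apply, data_k_zero_apply]

/-! ### The derivative of the mean curvature -/

/-- The directional derivative `∂_Z tr_h k` of the closed form `trRep` (with `t = ⟪y, Z⟫`,
`S = √(1 + 2M/r)`, `n = 2M(r + 3M)`, `W = r² S (r + 2M)`): `−(dn W − n dW)/W²`,
`dn = 2Mt/r`, `dW = (2tS − Mt/(rS))(r + 2M) + r² S t/r`. [cite: Cook2000, §3.2.2 (57)] -/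
def dtrRep (M : ℝ) (y Z : E3) : ℝ :=
  let r := ‖y‖
  let S := √(1 + 2 * M / ‖y‖)
  let t := ⟪y, Z⟫_ℝ
  let n := 2 * M * (r + 3 * M)
  let dn := 2 * M * (t / r)
  let W := r ^ 2 * S * (r + 2 * M)
  let dW := (2 * t * S - M * t / (r * S)) * (r + 2 * M) + r ^ 2 * S * (t / r)
  (n * dW - dn * W) / W ^ 2

section TrRepCalculus

variable {M : ℝ} {y : E3}

/-- **The closed form `trRep` of the mean curvature is differentiable in the point, with
directional derivative `dtrRep`** (`M ≥ 0`, `y ≠ 0`). [cite: Cook2000, §3.2.2 (57)] -/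
theorem hasFDerivAt_trRep (hM : 0 ≤ M) (hy : y ≠ 0) :
    ∃ D : E3 →L[ℝ] ℝ, HasFDerivAt (trRep M) D y ∧ ∀ Z, D Z = dtrRep M y Z := by
  have hr : ‖y‖ ≠ 0 := norm_ne_zero_iff.2 hy
  have hrpos : 0 < ‖y‖ := norm_pos_iff.2 hy
  have hpos : 0 < 1 + 2 * M / ‖y‖ := by positivity
  have hS : √(1 + 2 * M / ‖y‖) ≠ 0 := (Real.sqrt_pos.2 hpos).ne'
  have hA := hasFDerivAt_normSq_mul_sqrt hM hy
  have hW := hA.mul ((hasFDerivAt_norm_E3 hy).add_const (2 * M))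
  have hW0 : ‖y‖ ^ 2 * √(1 + 2 * M / ‖y‖) * (‖y‖ + 2 * M) ≠ 0 := by positivity
  have hWinv := (hasDerivAt_inv hW0).comp_hasFDerivAt y hW
  have hn := ((hasFDerivAt_norm_E3 hy).add_const (3 * M)).const_mul (2 * M)
  have h := (hn.mul hWinv).neg
  refine ⟨_, h.congr_of_eventuallyEq (Filter.Eventually.of_forall fun y' ↦ ?_), fun Z ↦ ?_⟩
  · simp only [trRep, Pi.mul_apply, Pi.neg_apply, Function.comp_apply, div_eq_mul_inv]
  · simp only [dtrRep, add_apply, neg_apply, FunLike.coe_smul, Pi.smul_apply, smul_eq_mul,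
      E3.covec_apply, Pi.mul_apply, Function.comp_apply, mul_neg, neg_mul]
    field_simp
    ring

/-- `trRep M` is differentiable off the origin (`M ≥ 0`). [cite: Cook2000, §3.2.2 (57)] -/
theorem differentiableAt_trRep (hM : 0 ≤ M) (hy : y ≠ 0) : DifferentiableAt ℝ (trRep M) y := by
  obtain ⟨D, hD, -⟩ := hasFDerivAt_trRep hM hy
  exact hD.differentiableAt

/-- **`∂_Z trRep = dtrRep M y Z`** off the origin (`M ≥ 0`). [cite: Cook2000, §3.2.2 (57)] -/
theorem fderiv_trRep_apply (hM : 0 ≤ M) (hy : y ≠ 0) (Z : E3) :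
    fderiv ℝ (trRep M) y Z = dtrRep M y Z := by
  obtain ⟨D, hD, hDZ⟩ := hasFDerivAt_trRep hM hy
  rw [hD.fderiv, hDZ]

end TrRepCalculus

/-- **The differential of the mean curvature of the Schwarzschild slice**: for `M ≥ 0`,
`d(tr_h k)_y (Z) = dtrRep M y Z` (the mean curvature has the representative `trRep M`,
`traceK_data_zero`, differentiated in the chart, `OpensChart.mfderiv_eq`). [cite: Cook2000, §3.2.2 (57)] -/
theorem mfderiv_traceK_data_zero [Facts] [SliceFacts] (M : ℝ) (hM : 0 ≤ M) {r₀ : ℝ}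
    (y : slice 0 r₀) (Z : E3) :
    mfderiv 𝓘(ℝ, E3) 𝓘(ℝ, ℝ) (data M 0 r₀ hM).traceK y Z = dtrRep M y Z := by
  have hy : (y : E3) ≠ 0 := ne_zero_of_mem_slice_zero y
  rw [OpensChart.mfderiv_eq y (data M 0 r₀ hM).traceK (trRep M) (fun y' ↦ traceK_data_zero M hM y')
    (differentiableAt_trRep hM hy)]
  exact fderiv_trRep_apply hM hy Z

/-! ### The momentum constraint -/

/-- **The momentum constraint for the Schwarzschild Kerr–Schild slice**: `div_h k − d(tr_h k) = 0`.
The divergence `(div k)(Y₀) = ∑ g^{ji} (∇_{βⱼ} k)(βᵢ, Y₀)` (O'Neill 1983, Ch. 3, p. 86) is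
expanded in an orthonormal basis adapted to the point (`exists_orthonormalBasis_adapted`; diagonal
inverse Gram matrix `gram_hRep_adapted_inv`) with `covDeriv₂_data_k_zero`, the Christoffel map
`christoffel_data_zero` and the closed forms `kRep`, `dkRep`; the differential of the mean
curvature is `mfderiv_traceK_data_zero`; the resulting identity, rational in `r`, `S` after
eliminating `M = r(S² − 1)/2`, is checked on each basis vector. Choquet-Bruhat 2009, Ch. VI,
Thm. 3.3 and (3.11); Cook 2000, §3.2.2. [cite: ChoquetBruhat2009, Ch. VI, Thm. 3.3] -/
theorem momentumConstraintFn_data_zero [Facts] [SliceFacts] (M : ℝ) (hM : 0 ≤ M) {r₀ : ℝ}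
    (y : slice 0 r₀) [(data M 0 r₀ hM).metric.HasLeviCivita] :
    (data M 0 r₀ hM).momentumConstraintFn y = 0 := by
  have hy : (y : E3) ≠ 0 := ne_zero_of_mem_slice_zero y
  have hr : ‖(y : E3)‖ ≠ 0 := norm_ne_zero_iff.2 hy
  have hrpos := norm_pos_of_mem_slice_zero y
  have hrM : ‖(y : E3)‖ + 2 * M ≠ 0 := by positivity
  have h1S : 1 + 2 * M / ‖(y : E3)‖ ≠ 0 := by positivity
  have hSpos : 0 < √(1 + 2 * M / ‖(y : E3)‖) := Real.sqrt_pos.2 (by positivity)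
  have hS2 : √(1 + 2 * M / ‖(y : E3)‖) ^ 2 = 1 + 2 * M / ‖(y : E3)‖ := Real.sq_sqrt (by positivity)
  obtain ⟨b, hb⟩ := exists_orthonormalBasis_adapted hy
  set β : Module.Basis (Fin 3) ℝ (TangentSpace 𝓘(ℝ, E3) y) := b.toBasis with hβdef
  have hβ : ∀ i, β i = b i := fun i ↦ congrFun b.coe_toBasis i
  have hval : ∀ i j, (data M 0 r₀ hM).metric.val y (β i) (β j) = hRep M y (b i) (b j) := by
    intro i j; rw [data_metric_val_zero M hM y, hβ, hβ]; rfl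
  have hyb : ∀ i, ⟪b i, (y : E3)⟫_ℝ = if i = 2 then ‖(y : E3)‖ else 0 := fun i ↦ by
    rw [real_inner_comm, inner_adapted b hb]
  -- it suffices to check the covector on the basis `b`
  refine (β.ext fun m ↦ ?_ : (data M 0 r₀ hM).momentumConstraintFn y = 0)
  rw [LinearMap.zero_apply, InitialDataSet.momentumConstraintFn_apply,
    PseudoRiemannianMetric.divergence_apply, trace_eq_sum_gram_inv _ y β]
  simp only [PseudoRiemannianMetric.divergenceAux_apply, hval]
  rw [gram_hRep_adapted_inv hy b hb hrM]
  simp only [Matrix.diagonal_apply, ite_mul, zero_mul, Finset.sum_ite_eq', Finset.mem_univ,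
    if_true, hβ]
  simp only [mfderiv_traceK_data_zero M hM y, covDeriv₂_data_k_zero M hM y,
    christoffel_data_zero M hM y, kRep, dkRep, dtrRep,
    cKS_adapted b hb, inner_adapted b hb, inner_basis b, hyb, inner_smul_left, inner_smul_right,
    real_inner_self_eq_norm_sq, conj_trivial, Fin.sum_univ_three, Fin.isValue,
    Matrix.cons_val_zero, Matrix.cons_val_one, Matrix.cons_val,
    show ((0 : Fin 3) = 2) = False by decide, show ((1 : Fin 3) = 2) = False by decide,
    if_true, if_false, mul_zero, zero_mul, mul_one, one_mul, add_zero, zero_add, sub_zero]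
  -- eliminate `M` in favour of `S = √(1 + 2M/r)`: `M = r (S² − 1)/2`
  generalize hSg : √(1 + 2 * M / ‖(y : E3)‖) = S at hS2 hSpos ⊢
  have hM' : M = ‖(y : E3)‖ * (S ^ 2 - 1) / 2 := by
    field_simp at hS2
    linarith
  subst hM'
  by_cases hm : m = 2
  · subst hm
    simp only [if_true]
    field_simp
    ring
  · simp only [hm, Ne.symm hm, if_false, mul_zero, zero_mul, add_zero, sub_zero]
    field_simp
    ring

/-! ### The vacuum constraints -/

/-- **The Schwarzschild Kerr–Schild slice data solve the vacuum constraint equations** — the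
`a = 0` instance of the named fact `Kerr.data_isVacuumConstraintSolution` (`KerrData.lean`),
now a theorem: for every `M ≥ 0` (the fact's leading binder), every inner radius `r₀` and every
point of the slice `{t* = 0} ∩ {‖y‖ > max r₀ 0}`, the data `(h, k)` induced by the Schwarzschild
metric in ingoing Kerr–Schild (Eddington–Finkelstein) coordinates satisfy
`R(h) − |k|²_h + (tr_h k)² = 0` and `div_h k − d(tr_h k) = 0`
(`hamiltonianConstraintFn_data_zero`, `momentumConstraintFn_data_zero`). Choquet-Bruhat 2009,
Ch. VI, Thm. 3.3 (data induced on a spacelike hypersurface of a vacuum spacetime solve the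
constraints); García-Parrado–Valiente Kroon 2008, §5 and Cook 2000, §3.2.2 (Kerr–Schild slices).
[cite: ChoquetBruhat2009, Ch. VI, Thm. 3.3] -/
theorem data_isVacuumConstraintSolution_zero [Facts] [SliceFacts] (M r₀ : ℝ) :
    data_isVacuumConstraintSolution M 0 r₀ := by
  intro hM _ y
  exact ⟨hamiltonianConstraintFn_data_zero M hM y, momentumConstraintFn_data_zero M hM y⟩

end Kerr

end Literature.Geometry.Lorentzian

end
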